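/-
Copyright (c) 2026. All rights reserved.
Released under Apache 2.0 license as described in the file LICENSE.
Authors: abc-iut cell, prover seat abc-iut-f-101 (gen 5; row «SB′-D2», abc-iut-L4-lead m136), over abc-iut-w5-d144's
`LogFrobeniusObservablesOver` / `LogFrobeniusObservablesTSOver` (the observables' own over-data `logPlusOverE`, `logTSOverE`)
and this seat's `LogFrobeniusMonoTelecoreOver` (`monoTeleOver`) / `LogFrobeniusMonoTelecoreObservablesShape` (`embPlusHom`).
-/
import Literature.AnabelianGeometry.AbsoluteAnabelian.LogFrobeniusMonoTelecoreObservablesShape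
import Literature.AnabelianGeometry.AbsoluteAnabelian.LogFrobeniusObservablesTSOver
import HarnessLib

/-!
# [AbsTopIII] Cor 5.10 (iv)(b), last sentence — the `TS`-observable's over-datum and the core over-datum of `D_{An⊢}` agree

S. Mochizuki, *Topics in absolute anabelian geometry III: global reconstruction algorithms*,
J. Math. Sci. Univ. Tokyo 22 (2015) 939–1156 [MochizukiAbsTopIII2015]; manuscript `paper:url-5493eb38cbb7`: Rmk 3.5.1 p. 78
(structure functors: a core as «a sort of 'constant portion' of the diagram that lies, in a consistent fashion, 'under the
entire diagram'»), Def 5.4 (ii)/(iv) pp. 125–127 (`log•_{T,T}`, `λ⊞_{v,ν}` lie over `Th•[Z]`), Cor 5.10 (iv)(b) pp. 147–148.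

BRIDGE between the two presentations of «lies over» used by the Cor 5.10 (iv)(b) compatibility closer
(`cor510MonoTelecoreObservablesCompatible_of`, hypotheses `hoverPlus` / `hoverTS` read INSIDE `D_{An⊢}` against this seat's
`monoTeleOver hN hψ` over the core `An⊢[𝒩⊢⊞]`) and by its suppliers (abc-iut-w5-d144's `isOver_logObsFamily_η_map` /
`isOver_logObsFamilyTS_η_map`, against the observables' own over-data `logPlusOverE v` / `logTSOverE v` over `Th•[Z]`, mapped along
`Th•[Z] → Th⊢[Z] ⥲ An⊢[𝒩⊢⊞]`): along the embeddings `embMonoPlus`, `embMonoTS` the structure functors AGREE (`proj ⋙ monoAn ⋙ κ`,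
`λ`-rows likewise) and so do the over-isomorphisms of every arrow (`logOver`, unitor, `lamOver`, identity — the same interface
data on both sides), hence the `pathIso` of every embedded path (`pathIso_embMonoPlus_hom_app_heq`, by induction) and
★ `isOver_embPlusHom` / `isOver_embTSHom`: a homotopy of `S_log⊞_v` / `S_log_v` lying over `Th•[Z]` for the observable's over-datum
lies, read in `D_{An⊢}`, over the core.  OUR kernel bookkeeping; nothing here bears on [IUTchIII] Cor. 3.12; no side taken.
-/

set_option autoImplicit false

universe u

open CategoryTheory Quiver

namespace Literature.AnabelianGeometry.AbsoluteAnabelian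

namespace LogFrobeniusSetting

open DiagramOfCategories

variable {Vmod : Type u} {isArc : Vmod → Bool} (L : LogFrobeniusSetting Vmod isArc)
  (hN : ∀ v : Vmod, L.monoN v ⋙ L.toEmono v ≅ L.toE v ⋙ L.monoAn)
  (hψ : ∀ (w : Vmod) (j : {ν : LogVertex (isArc w) // ν.IsCross}),
    L.ψAnMono w j ⋙ L.forgetMono w ⋙ L.toEmono w ≅ L.κAnMono.inverse)
  (v : Vmod)

/-! ## Bookkeeping -/

/-- Objects under heterogeneously equal functors (bookkeeping). [folklore] -/
private theorem obj_heq_of_heq {A A' B B' : Type (u + 1)} [iA : Category.{u} A] [iA' : Category.{u} A']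
    [iB : Category.{u} B] [iB' : Category.{u} B'] (hA : A = A') (hiA : HEq iA iA') (hB : B = B') (hiB : HEq iB iB')
    {F : A ⥤ B} {G : A' ⥤ B'} (h : HEq F G) {x : A} {x' : A'} (hx : HEq x x') : HEq (F.obj x) (G.obj x') := by
  subst hA hB; cases hiA; cases hiB; cases h; cases hx; rfl

/-- `eqToHom`s between pairwise equal objects are heterogeneously equal (bookkeeping). [folklore] -/
private theorem eqToHom_heq_eqToHom {C : Type*} [Category C] {A B A' B' : C} (hA : A = A') (hB : B = B') (h : A = B)
    (h' : A' = B') : HEq (eqToHom h) (eqToHom h') := by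
  subst hA hB; rfl

/-- `eqToHom`s with a common target (up to equality) are heterogeneously equal (bookkeeping). [folklore] -/
private theorem eqToHom_heq_eqToHom_of_eq {C : Type*} [Category C] {A B A' B' : C} (h : A = B) (h' : A' = B')
    (hB : B = B') : HEq (eqToHom h) (eqToHom h') := by
  subst h h' hB; rfl

/-- Edge functors of equal diagrams are heterogeneously equal (bookkeeping). [folklore] -/
private theorem map_heq_of_diagram_eq {W : Type*} [Quiver W] {D₁ D₂ : DiagramOfCategories W} (h : D₁ = D₂) {a b : W}
    (e : a ⟶ b) : HEq (D₁.map e) (D₂.map e) := by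
  subst h; rfl

/-- `𝟙 ≫ F(𝟙) ≫ g ≍ g` (bookkeeping for unfolded over-isomorphisms). [folklore] -/
private theorem id_comp_map_id_comp_heq {C D : Type*} [Category C] [Category D] (F : C ⥤ D) {X : C} {Y : D}
    (g : F.obj X ⟶ Y) : HEq (𝟙 (F.obj X) ≫ F.map (𝟙 X) ≫ g) g := by
  simp

/-- `𝟙 ≫ F(𝟙) ≍ F(G(𝟙))` (bookkeeping). [folklore] -/
private theorem id_comp_map_id_heq {B C D : Type*} [Category B] [Category C] [Category D] (F : C ⥤ D) (G : B ⥤ C) (Z : B) :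
    HEq (𝟙 (F.obj (G.obj Z)) ≫ F.map (𝟙 (G.obj Z))) (F.map (G.map (𝟙 Z))) := by
  simp

/-- `𝟙 ≫ F(𝟙) ≫ F(G(𝟙) ≫ G f) ≍ F(G f)` (bookkeeping). [folklore] -/
private theorem id_comp_map_id_comp_map_heq {B C D : Type*} [Category B] [Category C] [Category D] (F : C ⥤ D) (G : B ⥤ C)
    {W W' : B} (f : W ⟶ W') : HEq (𝟙 (F.obj (G.obj W)) ≫ F.map (𝟙 (G.obj W)) ≫ F.map (G.map (𝟙 W) ≫ G.map f)) (F.map (G.map f)) := by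
  simp


/-- Inverses of heterogeneously equal isomorphisms (bookkeeping). [folklore] -/
private theorem heq_inv_of_heq_hom {C : Type*} [Category C] {A B A' B' : C} (hA : A = A') (hB : B = B') {i : A ≅ B}
    {j : A' ≅ B'} (h : HEq i.hom j.hom) : HEq i.inv j.inv := by
  subst hA hB
  obtain rfl := Iso.ext (eq_of_heq h)
  rfl

/-! ## `TS`: structure functors and over-isomorphisms agree along `embMonoTS` -/

section TS

/-- The structure functor of `D_{An⊢}` at an embedded vertex of `(D•_{≤3})_v ∪ {𝒩_v}` IS the observable's structure functor followed
by `Th•[Z] → An⊢` (heterogeneously: the vertex categories agree after case analysis). [cite: MochizukiAbsTopIII2015, Remark 3.5.1 p.78] -/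
theorem monoTeleOver_N_embMonoTS_heq (a : (logShapeTS (isArc := isArc) v).Vertex) :
    HEq ((L.monoTeleOver hN hψ).N ((embMonoTS (monoJ (Vmod := Vmod)) v).obj a))
      ((L.logTSOverE v).N a ⋙ (L.monoAn ⋙ L.κAnMono.functor)) := by
  rcases a with ⟨⟨yv, hy⟩⟩ | _
  · cases yv <;> first | exact HEq.rfl | exact absurd hy (by rintro (h | h) <;> [exact absurd h.2 (by simp [DVertex.row]); cases h])
  · exact HEq.rfl

/-- Objects: the same identification applied to heterogeneously equal objects. [cite: MochizukiAbsTopIII2015, Remark 3.5.1 p.78] -/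
theorem monoTeleOver_N_embMonoTS_obj (a : (logShapeTS (isArc := isArc) v).Vertex)
    {y : L.monoTeleDiagram.obj ((embMonoTS (monoJ (Vmod := Vmod)) v).obj a)} {y' : (L.logDiagramTS v).obj a}
    (hy : HEq y y') :
    ((L.monoTeleOver hN hψ).N ((embMonoTS (monoJ (Vmod := Vmod)) v).obj a)).obj y =
      (L.monoAn ⋙ L.κAnMono.functor).obj (((L.logTSOverE v).N a).obj y') := by
  rcases a with ⟨⟨yv, hya⟩⟩ | _
  · cases yv <;> first | (cases hy; rfl) | exact absurd hya (by rintro (h | h) <;> [exact absurd h.2 (by simp [DVertex.row]); cases h])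
  · cases hy; rfl

/-- The over-isomorphism of `D_{An⊢}` at an embedded arrow (`logOver`, unitor, `lamOver` whiskered into `An⊢`) IS the observable's
over-isomorphism mapped along `Th•[Z] → An⊢`, componentwise. [cite: MochizukiAbsTopIII2015, Remark 3.5.1 p.78] -/
theorem monoTeleOver_μ_embMonoTS_app_heq {a b : (logShapeTS (isArc := isArc) v).Vertex} (e : a ⟶ b)
    {y : L.monoTeleDiagram.obj ((embMonoTS (monoJ (Vmod := Vmod)) v).obj a)} {y' : (L.logDiagramTS v).obj a}
    (hy : HEq y y') :
    HEq (((L.monoTeleOver hN hψ).μ ((embMonoTS (monoJ (Vmod := Vmod)) v).map e)).hom.app y)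
      ((L.monoAn ⋙ L.κAnMono.functor).map (((L.logTSOverE v).μ e).hom.app y')) := by
  rcases a with ⟨⟨yv, hya⟩⟩ | _ <;> rcases b with ⟨⟨zv, hzb⟩⟩ | _
  · change DEdge isArc yv zv at e
    cases e with
    | log n =>
      cases hy
      simp [monoTeleOver, DiagramOfCategories.teleOver, DiagramOfCategories.OverData.extendOver, monoOver,
        monoStructIso, logTSOverE, tsμ, embMonoTS]
      exact id_comp_map_id_comp_heq L.κAnMono.functor _
    | toCore n =>
      cases hy
      simp [monoTeleOver, DiagramOfCategories.teleOver, DiagramOfCategories.OverData.extendOver, monoOver,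
        monoStructIso, logTSOverE, tsμ, embMonoTS]
      exact id_comp_map_id_heq L.κAnMono.functor L.monoAn (L.proj.obj y)
    | lam w ν hν =>
      cases hy
      simp [monoTeleOver, DiagramOfCategories.teleOver, DiagramOfCategories.OverData.extendOver, monoOver,
        monoStructIso, logTSOverE, tsμ, embMonoTS]
      exact id_comp_map_id_comp_map_heq L.κAnMono.functor L.monoAn ((L.lamOver w ν).hom.app y)
    | forget w => exact absurd hzb (by rintro (h | h) <;> [exact absurd h.2 (by simp [DVertex.row]); cases h])
    | toE w => exact absurd hya (by rintro (h | h) <;> [exact absurd h.2 (by simp [DVertex.row]); cases h])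
    | κAn => exact absurd hya (by rintro (h | h) <;> [exact absurd h.2 (by simp [DVertex.row]); cases h])
    | anToE => exact absurd hya (by rintro (h | h) <;> [exact absurd h.2 (by simp [DVertex.row]); cases h])
    | monoNplus w => exact absurd hzb (by rintro (h | h) <;> [exact h.1.elim; cases h])
    | monoN w => exact absurd hzb (by rintro (h | h) <;> [exact h.1.elim; cases h])
    | monoE5 => exact absurd hzb (by rintro (h | h) <;> [exact h.1.elim; cases h])
    | monoAn => exact absurd hzb (by rintro (h | h) <;> [exact h.1.elim; cases h])
    | monoE7 => exact absurd hzb (by rintro (h | h) <;> [exact h.1.elim; cases h])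
    | forgetMono w => exact absurd hya (by rintro (h | h) <;> [exact h.1.elim; cases h])
    | toEmono w => exact absurd hya (by rintro (h | h) <;> [exact h.1.elim; cases h])
    | κAnMono => exact absurd hya (by rintro (h | h) <;> [exact h.1.elim; cases h])
    | anMonoToE => exact absurd hya (by rintro (h | h) <;> [exact h.1.elim; cases h])
  · change DEdge isArc yv (.nv v) at e
    cases e with
    | forget w =>
      cases hy
      simp [monoTeleOver, DiagramOfCategories.teleOver, DiagramOfCategories.OverData.extendOver, monoOver,
        monoStructIso, logTSOverE, tsμObs, embMonoTS]
      exact id_comp_map_id_heq L.κAnMono.functor L.monoAn _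
  · exact PEmpty.elim e
  · exact PEmpty.elim e

/-- The path functors agree on objects along `embMonoTS` (heterogeneously). [cite: MochizukiAbsTopIII2015, Definition 3.5 (i) p.75] -/
theorem pathFunctor_embMonoTS_obj_heq {a b : (logShapeTS (isArc := isArc) v).Vertex} (p : Path a b)
    {x : L.monoTeleDiagram.obj ((embMonoTS (monoJ (Vmod := Vmod)) v).obj a)} {x' : (L.logDiagramTS v).obj a}
    (hx : HEq x x') :
    HEq ((L.monoTeleDiagram.pathFunctor ((embMonoTS (monoJ (Vmod := Vmod)) v).mapPath p)).obj x)
      (((L.logDiagramTS v).pathFunctor p).obj x') := by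
  have hD := L.logDiagramTS_eq_comapAlong v
  have hF : HEq (L.monoTeleDiagram.pathFunctor ((embMonoTS (monoJ (Vmod := Vmod)) v).mapPath p))
      ((L.logDiagramTS v).pathFunctor p) :=
    (heq_of_eq (L.monoTeleDiagram.pathFunctor_comapAlong (embMonoTS monoJ v) p)).symm.trans
      (DiagramOfCategories.pathFunctor_heq_of_eq hD p).symm
  exact obj_heq_of_heq (congrArg (fun D => D.obj a) hD).symm (by rw [hD]) (congrArg (fun D => D.obj b) hD).symm
    (by rw [hD]) hF hx

/-- The edge functors agree on objects along `embMonoTS` (heterogeneously). [cite: MochizukiAbsTopIII2015, Definition 3.5 (i) p.75] -/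
theorem map_embMonoTS_obj_heq {a b : (logShapeTS (isArc := isArc) v).Vertex} (e : a ⟶ b)
    {y : L.monoTeleDiagram.obj ((embMonoTS (monoJ (Vmod := Vmod)) v).obj a)} {y' : (L.logDiagramTS v).obj a}
    (hy : HEq y y') :
    HEq ((L.monoTeleDiagram.map ((embMonoTS (monoJ (Vmod := Vmod)) v).map e)).obj y) (((L.logDiagramTS v).map e).obj y') := by
  have hD := L.logDiagramTS_eq_comapAlong v
  exact obj_heq_of_heq (congrArg (fun D => D.obj a) hD).symm (by rw [hD]) (congrArg (fun D => D.obj b) hD).symm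
    (by rw [hD]) (map_heq_of_diagram_eq hD e).symm hy

/-- ★ The `pathIso` of `D_{An⊢}` along an embedded path IS the observable's `pathIso` mapped along `Th•[Z] → An⊢`, componentwise
(induction on the path; Rmk 3.5.1). [cite: MochizukiAbsTopIII2015, Remark 3.5.1 p.78] -/
theorem pathIso_embMonoTS_hom_app_heq {a : (logShapeTS (isArc := isArc) v).Vertex} :
    ∀ {b : (logShapeTS (isArc := isArc) v).Vertex} (p : Path a b)
      {x : L.monoTeleDiagram.obj ((embMonoTS (monoJ (Vmod := Vmod)) v).obj a)} {x' : (L.logDiagramTS v).obj a}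
      (_ : HEq x x'),
      HEq (((L.monoTeleOver hN hψ).pathIso ((embMonoTS (monoJ (Vmod := Vmod)) v).mapPath p)).hom.app x)
        ((L.monoAn ⋙ L.κAnMono.functor).map (((L.logTSOverE v).pathIso p).hom.app x'))
  | _, Path.nil, x, x', hx => by
    rw [Prefunctor.mapPath_nil, OverData.pathIso_nil_app, OverData.pathIso_nil_app, eqToHom_map]
    exact eqToHom_heq_eqToHom_of_eq _ _ (L.monoTeleOver_N_embMonoTS_obj hN hψ v a hx)
  | _, Path.cons (b := b) (c := c) p e, x, x', hx => by
    rw [Prefunctor.mapPath_cons, OverData.pathIso_cons_app, OverData.pathIso_cons_app, Functor.map_comp, Functor.map_comp,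
      eqToHom_map]
    have hy := L.pathFunctor_embMonoTS_obj_heq v p hx
    have hy' := L.pathFunctor_embMonoTS_obj_heq v (p.cons e) hx
    have hz := L.map_embMonoTS_obj_heq v e hy
    exact heq_comp (L.monoTeleOver_N_embMonoTS_obj hN hψ v c hy') (L.monoTeleOver_N_embMonoTS_obj hN hψ v c hz)
      (L.monoTeleOver_N_embMonoTS_obj hN hψ v a hx)
      (eqToHom_heq_eqToHom_of_eq _ _ (L.monoTeleOver_N_embMonoTS_obj hN hψ v c hz))
      (heq_comp (L.monoTeleOver_N_embMonoTS_obj hN hψ v c hz) (L.monoTeleOver_N_embMonoTS_obj hN hψ v b hy)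
        (L.monoTeleOver_N_embMonoTS_obj hN hψ v a hx) (L.monoTeleOver_μ_embMonoTS_app_heq hN hψ v e hy)
        (pathIso_embMonoTS_hom_app_heq p hx))


/-- ★★ **BRIDGE (`TS`)**: a homotopy of a pair of paths of `S_log_v` (source in `D•_{≤2}`) into `𝒩_v` lying over `Th•[Z]` for the
observable's own over-datum (abc-iut-w5-d144's `logTSOverE v`, read under `Th•[Z] → Th⊢[Z] ⥲ An⊢[𝒩⊢⊞]`) lies, read in `D_{An⊢}`
(`embTSHom`), over the core `An⊢[𝒩⊢⊞]` for this seat's `monoTeleOver` — the hypothesis `hoverTS` of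
`cor510MonoTelecoreObservablesCompatible_of`, from abc-iut-w5-d144's `isOver_logObsFamilyTS_η_map`.
[cite: MochizukiAbsTopIII2015, Remark 3.5.1 p.78] -/
theorem isOver_embTSHom (H : (L.logDiagramTS v).HomotopyFamily) (x : DSub (InPortionThree (isArc := isArc) v))
    {p q : Path ((logShapeTS (isArc := isArc) v).base x) (logShapeTS (isArc := isArc) v).obs} (h : H.E p q)
    (ho : ((L.logTSOverE v).map (L.monoAn ⋙ L.κAnMono.functor)).IsOver p q (H.η h)) :
    (L.monoTeleOver hN hψ).IsOver ((embMonoTS (monoJ (Vmod := Vmod)) v).mapPath p)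
      ((embMonoTS (monoJ (Vmod := Vmod)) v).mapPath q) (L.embTSHom v H h) := by
  refine OverData.isOver_of_map_app fun X => ?_
  have hsmall := ho.map_app X
  rw [OverData.map_pathIso_hom_app, OverData.map_pathIso_inv_app] at hsmall
  have hD := L.logDiagramTS_eq_comapAlong v
  have hF : ∀ r : Path ((logShapeTS (isArc := isArc) v).base x) (logShapeTS (isArc := isArc) v).obs,
      (L.logDiagramTS v).pathFunctor r = L.monoTeleDiagram.pathFunctor ((embMonoTS (monoJ (Vmod := Vmod)) v).mapPath r) :=
    fun r => eq_of_heq ((DiagramOfCategories.pathFunctor_heq_of_eq hD r).trans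
      (heq_of_eq (L.monoTeleDiagram.pathFunctor_comapAlong (embMonoTS monoJ v) r)))
  have hX : HEq X X := HEq.rfl
  -- the structure functor at `𝒩_v` applied to the homotopy's component: the same morphism on both sides
  have e1 : HEq (((L.logTSOverE v).N (logShapeTS (isArc := isArc) v).obs ⋙ (L.monoAn ⋙ L.κAnMono.functor)).map ((L.embTSHom v H h).app X))
      (((L.logTSOverE v).N (logShapeTS (isArc := isArc) v).obs ⋙ (L.monoAn ⋙ L.κAnMono.functor)).map ((H.η h).app X)) :=
    map_heq_of_heq _ (Functor.congr_obj (hF p) X).symm (Functor.congr_obj (hF q) X).symm (L.embTSHom_app_heq v H x h X)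
  -- the `pathIso`s agree
  have e2 := L.pathIso_embMonoTS_hom_app_heq hN hψ v p (x := X) (x' := X) hX
  have e3 : HEq (((L.monoAn ⋙ L.κAnMono.functor).mapIso (((L.logTSOverE v).pathIso q).app X)).inv)
      ((((L.monoTeleOver hN hψ).pathIso ((embMonoTS (monoJ (Vmod := Vmod)) v).mapPath q)).app X).inv) :=
    heq_inv_of_heq_hom (L.monoTeleOver_N_embMonoTS_obj hN hψ v _ (L.pathFunctor_embMonoTS_obj_heq v q hX)).symm
      (L.monoTeleOver_N_embMonoTS_obj hN hψ v _ hX).symm (L.pathIso_embMonoTS_hom_app_heq hN hψ v q hX).symm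
  refine eq_of_heq (e1.trans ((heq_of_eq hsmall).trans (heq_comp ?_ ?_ ?_ e2.symm e3)))
  · exact (L.monoTeleOver_N_embMonoTS_obj hN hψ v _ (L.pathFunctor_embMonoTS_obj_heq v p hX)).symm
  · exact (L.monoTeleOver_N_embMonoTS_obj hN hψ v _ hX).symm
  · exact (L.monoTeleOver_N_embMonoTS_obj hN hψ v _ (L.pathFunctor_embMonoTS_obj_heq v q hX)).symm

/-- … and the diagonal pairs at `𝒩_v` itself (`p = q = nil`: the embedded homotopy is the identity).
[cite: MochizukiAbsTopIII2015, Remark 3.5.1 p.78] -/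
theorem isOver_embTSHom_obs (H : (L.logDiagramTS v).HomotopyFamily)
    {p q : Path (logShapeTS (isArc := isArc) v).obs (logShapeTS (isArc := isArc) v).obs} (h : H.E p q) :
    (L.monoTeleOver hN hψ).IsOver ((embMonoTS (monoJ (Vmod := Vmod)) v).mapPath p)
      ((embMonoTS (monoJ (Vmod := Vmod)) v).mapPath q) (L.embTSHom v H h) := by
  have hout := ExtShape.isEmpty_hom_obs (logShapeTS (isArc := isArc) v) (fun _ => (inferInstance : IsEmpty PEmpty.{u + 1}))
  obtain rfl := path_eq_nil_of_isEmpty_hom hout p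
  obtain rfl := path_eq_nil_of_isEmpty_hom hout q
  have e : L.embTSHom v H h = 𝟙 _ := by
    rw [embTSHom, LiftPair.hom_ofMem, (L.tsComap v H).η_refl]
    simp
  rw [e]
  exact (L.monoTeleOver hN hψ).isOver_id _

/-- ★★ **The hypothesis `hoverTS` of the compatibility closer from over-ness for the observable's own over-datum** (all sources).
[cite: MochizukiAbsTopIII2015, Remark 3.5.1 p.78] -/
theorem isOver_embTSHom_of_isOver (H : (L.logDiagramTS v).HomotopyFamily)
    (ho : ∀ {a b : (logShapeTS (isArc := isArc) v).Vertex} {p q : Path a b} (h : H.E p q),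
      ((L.logTSOverE v).map (L.monoAn ⋙ L.κAnMono.functor)).IsOver p q (H.η h))
    (a : (logShapeTS (isArc := isArc) v).Vertex) (p q : Path a (logShapeTS (isArc := isArc) v).obs) (h : H.E p q) :
    (L.monoTeleOver hN hψ).IsOver ((embMonoTS (monoJ (Vmod := Vmod)) v).mapPath p)
      ((embMonoTS (monoJ (Vmod := Vmod)) v).mapPath q) (L.embTSHom v H h) := by
  rcases a with x | _
  · exact L.isOver_embTSHom hN hψ v H x h (ho h)
  · exact L.isOver_embTSHom_obs hN hψ v H h

end TS

end LogFrobeniusSetting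

end Literature.AnabelianGeometry.AbsoluteAnabelian
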